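import Summits.Ventures.CertifiedArithmetic.LowPrec.GemmThetaLawGenE3M2Data

/-!
# E3M2×E3M2 law check, part 7/11: `bin 8`, `bin 9`

HONEST FRAMING (venture CertifiedArithmetic / cell `pub-lowprec`, seat gemm, gen 13): certified
error envelopes and provably optimal rounding/accumulation schemes for low-precision formats under
stated cost models; every table by two implementations; no hardware or vendor claims.

Part 7/11 of the per-level kernel check of `e3m2Law.lawCheck` (see
`GemmThetaLawGenE3M2Data.lean`): `bin 8`, `bin 9` (2202 + 2102 classes). [cell]
-/

namespace Literature.ComputerArithmetic.FloatingPoint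

namespace MiniFloat

namespace ThetaLaw

/-- Level `bin 8` of the E3M2×E3M2 law check passes (2202 classes, both signs, all 291 letters).
[cell, kernel `decide`] -/
theorem levCheck_e3m2_b8 : e3m2Law.levCheck (Lev.bin 8) = true := by
  decide +kernel

/-- Level `bin 9` of the E3M2×E3M2 law check passes (2102 classes, both signs, all 291 letters).
[cell, kernel `decide`] -/
theorem levCheck_e3m2_b9 : e3m2Law.levCheck (Lev.bin 9) = true := by
  decide +kernel

end ThetaLaw

end MiniFloat

end Literature.ComputerArithmetic.FloatingPoint
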